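import Literature.MathematicalPhysics.QuantumFieldTheory.Balaban1983to89.Node00.Record13SepCoPH

/-!
# NODE 00 (YM-PLAN Track A) — THE PRINT-FAITHFUL TWO-SCALE LOCALITY LAW OF THE RESIDUAL 𝐓-WEIGHT FACTOR `ζ0`, BESIDE 12b's ONE-SCALE ROW
# (`TkResidualW.LocalLaws₂`; cure text (b′) of FLAG №1 N11 — plan g91 custodian word 2026-08-29T03:14Z; a LEAF edition: no law of record is edited, nothing re-keyed)

Cell `pub-ymgap`, seat `pub-ymgap-dag-n11-d` (g31) under the plan's word «def-T successor if seated, else n11-d files it under desk review» (no node00-def-T seat since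
08-27); item K1⁹ `StabilityBRunRowsAtRecordR13SepCoPHV` = stmt-QuantumFields-27364 (`--kind definition --supports 27364 --as helper`, count-neutral).
[III] = [Balaban1988Convergent].

WHY (located, first-hand).  [III] (3.1) p.264: `(Tρ_k)(V_{k+1}) = Σ ∫dV_k δ(V̄_k V_{k+1}⁻¹) χ_k T_k exp A_k`; p.264 bottom: «the restrictions introduced by χ_k imply that
the new fields V_{k+1} satisfy … We introduce new restrictions on these fields» — the decompositions of unity (3.2) (characteristic functions `χ_{k+1}(□)` of the NEW
field) and (3.3) (the old field against the one-cube backgrounds `V₀^{(k)} = M^k(U_{k+1,□})` of (3.4), determined by `V_{k+1}`); p.267: «for a fixed Ω_{k+1} we resum over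
admissible sets P_{k+1}, Q_{k+1} … The resummation applies only to the characteristic functions and the gauge fixing terms localized in Ω_k∖Ω_{k+1}.  Denote the sum
by ζ(Ω^c_{k+1})».  So print's residual factor of generation `k` READS THE NEW GAUGE FIELD `V_{k+1}` (and `V_k`).  In 11a's all-scales indexing (`Tk.MultiCfg`,
`Tk.vOp` reads the new field as `(ω (j+1)).1`) that is: `ζ0 j Y ω` may depend on `ω j` AND on `(ω (j+1)).1`.  12b's row of record `TkResidualW.LocalLaws.zeta0_local`
(`Record12` §3: `ω j = ω' j → ζ0 j Y ω = ζ0 j Y ω'`; = the field `zhLocal` of `Stage13HParams.Provisos₁₃CoPH` ∕ `Provisos₁₃SepCoPH`, `ztLocal` of `Provisos₁₂` ∕ `Provisos₁₃`)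
lets `ζ0 j` read `ω j` ONLY — STRONGER than print (12a's header, LOCATED (vi), says as much: print's `ζ0` «is NOT EXPRESSIBLE in the (j, Y, ω) signature»; the H edition
`Stage13HParams.Zh` supplied the history index, this file supplies the missing scale).  With 11a's base-configuration reading the one-scale row forces the top pair's
main term to be absent at every lawful `θ` (dag-n11-d g19, `Summit…BalabanUVNodesN11TopPairLocalResidual`, memo #40 on 27364) — FLAG №1 N11.  The plan's custodian
word (2026-08-29T03:14Z): «(b′) `zeta0_local₂ : ω j = ω' j → (ω (j+1)).1 = (ω' (j+1)).1 → ζ0 j Y ω = ζ0 j Y ω'` IS the print-faithful cure text of record; tree-first NOW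
under new names BESIDE the old; the K1⁹ re-pin (v11: `zhLocal` over `LocalLaws₂`) rides the next press».

WHAT THIS FILE DECLARES (1 structure, 2 named predicates; 0 `sorry`; standard axioms) AND PROVES.
§1 `TkResidualW.LocalLaws₂` — the TWO-SCALE locality law (FINE form: scale `j` and the GAUGE component of scale `j+1`; print-exact — at step `j` the fluctuation
   field of scale `j+1` does not exist yet).  Faces: `LocalLaws.localLaws₂` (12b's one-scale row implies it — so EVERY supplier of record supplies it),
   `LocalLaws₂.zeta0_twoScale` (the COARSE consequence `ω j = ω' j → ω (j+1) = ω' (j+1) → …`, the hypothesis shape the N11 reading-locus consumers display),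
   `localLaws₂_one` (unit residual), `ztLocalLaws₂_ZtOfRecordQ` ∕ `ztLocalLaws₂_ZtOfRecord` (K0b's residual of record).
§2 the θ-level named predicates `Stage12Params.ZtLocalLaws₂` (`∀ K, (θ.Zt K).LocalLaws₂`) and `Stage13HParams.ZhLocalLaws₂` (`∀ p n Ω Λ, (θ.Zh p n Ω Λ).LocalLaws₂`) —
   the texts a re-pinned proviso row would display — with `Stage13HParams.zhAt_localLaws₂` and the derivations from the rows of record
   (`Provisos₁₂.ztLocalLaws₂`, `Provisos₁₃.ztLocalLaws₂`, `Provisos₁₃CoPH.zhLocalLaws₂`, `Provisos₁₃SepCoPH.zhLocalLaws₂`, `HasResidualsOfRecord.ztLocalLaws₂`).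

HONEST SCOPE.  Definitions of record + one-line bookkeeping; the law is DISPLAYED, never posited of an object that lacks it; 12a ∕ 12b ∕ the H edition ∕ the proviso
structures are untouched and nothing is re-keyed here (the v11 re-pin is the plan's, at the next press).  NOT ASSERTED: anything of Bałaban; that print's `ζ(Ω^c_{k+1})`
is expressible at all in 11a's signature beyond the two scales (12a's located (vi) lists what else it reads: the `(P_{k+1}, Q_{k+1})`-resummation is a function of
`(V_k, V_{k+1})` on `Ω_k ∖ Ω_{k+1}` and of the history — the latter is the H edition's index).  K1⁹ `∃θ` NOT refuted; N11 NOT discharged; counts unmoved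
(typed 28∕28 · discharged 7∕27).  One finite `T⁴` programme at fixed `ε = L^{−K}`; not continuum ∕ OS ∕ mass-gap ∕ Clay.  No `sorry`, `axiom`, `instance`, `notation`.
-/

noncomputable section

namespace Literature.MathematicalPhysics.QuantumFieldTheory.Balaban1983to89.Node00

open T4Continuum

variable (F : T4Family) (N : ℕ) [NeZero N]

/-! ## §1  The two-scale locality law of a residual 𝐓-weight datum -/

variable {F N} in
/-- **PRINT'S TWO-SCALE LOCALITY LAW OF THE RESIDUAL 𝐓-WEIGHT FACTOR** (cure text (b′) of FLAG №1 N11, BESIDE 12b's one-scale `TkResidualW.LocalLaws`): `ζ0 j Y`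
reads only the scale-`j` step variables AND the scale-`(j+1)` GAUGE variables — `ω j = ω' j → (ω (j+1)).1 = (ω' (j+1)).1 → ζ0 j Y ω = ζ0 j Y ω'`.  Print's
`ζ(Ω^c_{k+1})` is the resummation of the (3.2)∕(3.3) characteristic functions and gauge-fixing factors in `Ω_k ∖ Ω_{k+1}`, functions of `V_k` and of the NEW field
`V_{k+1}` ((3.2) restricts `V_{k+1}`; (3.3)–(3.4) read `V_k` against `M^k(U_{k+1,□})`). [cite: Balaban1988Convergent, (3.1) p.264, (3.2)–(3.4) p.265, p.267] -/
structure TkResidualW.LocalLaws₂ {V : Type} {K : ℕ} (Z : TkResidualW F N V K) : Prop where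
  /-- `ζ0` at generation `j` is a function of the scale-`j` configuration and the scale-`(j+1)` gauge variables only -/
  zeta0_local₂ : ∀ (j : ℕ) (Y : Set (Site (F.P K) 0)) (ω ω' : Tk.MultiCfg (F.P K) (SU N) V),
    ω j = ω' j → (ω (j + 1)).1 = (ω' (j + 1)).1 → Z.ζ0 j Y ω = Z.ζ0 j Y ω'

variable {F N} in
omit [NeZero N] in
/-- **12b's ONE-SCALE ROW IMPLIES THE TWO-SCALE LAW** — so every supplier of record of `LocalLaws` (K0b's `ZtOfRecord`, K0a's `ZrOfRecord₁₃`, the pins) supplies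
`LocalLaws₂`, and a proviso row re-pinned to `LocalLaws₂` is WEAKER than the row of record. [cite: Balaban1988Convergent, (3.2)–(3.3) p.265, p.267 (bookkeeping)] -/
theorem TkResidualW.LocalLaws.localLaws₂ {V : Type} {K : ℕ} {Z : TkResidualW F N V K} (h : Z.LocalLaws) : Z.LocalLaws₂ :=
  -- v1.2 (W2 of the FLAG №1 R2b cure, dag-n11-d g32 2026-08-29): ARITY-ROBUST — elaborates under the one-scale row of record AND under its in-place
  -- two-scale re-typing (T1′), so the leaf never goes red in the window (`tauto` closes `E` from `e : E`, and `E` from `e : A → E`, `hj' : A`).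
  ⟨fun j Y ω ω' hj hj' => by have e := h.zeta0_local j Y ω ω' hj; tauto⟩

variable {F N} in
omit [NeZero N] in
/-- **THE COARSE CONSEQUENCE** (the hypothesis shape the N11 reading-locus consumers display): under the two-scale law, configurations agreeing at scales `j`
and `j+1` (both components) have the same `ζ0 j Y`. [cite: Balaban1988Convergent, (3.2)–(3.3) p.265, p.267 (bookkeeping)] -/
theorem TkResidualW.LocalLaws₂.zeta0_twoScale {V : Type} {K : ℕ} {Z : TkResidualW F N V K} (h : Z.LocalLaws₂) (j : ℕ) (Y : Set (Site (F.P K) 0))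
    (ω ω' : Tk.MultiCfg (F.P K) (SU N) V) (hj : ω j = ω' j) (hj' : ω (j + 1) = ω' (j + 1)) : Z.ζ0 j Y ω = Z.ζ0 j Y ω' :=
  h.zeta0_local₂ j Y ω ω' hj (by rw [hj'])

variable {F N} in
omit [NeZero N] in
/-- **k-LOCALITY BELOW `k`** (the form the no-expansion leaf files consume): under the two-scale law, configurations agreeing at every scale `≤ k` have the same
`ζ0 j Y` for every `j < k`. [cite: Balaban1988Convergent, (3.2)–(3.3) p.265, p.267, (2.20)–(2.21) p.258 (bookkeeping)] -/
theorem TkResidualW.LocalLaws₂.zeta0_local_lt {V : Type} {K : ℕ} {Z : TkResidualW F N V K} (h : Z.LocalLaws₂) {k j : ℕ} (hjk : j < k)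
    (Y : Set (Site (F.P K) 0)) (ω ω' : Tk.MultiCfg (F.P K) (SU N) V) (hω : ∀ i, i ≤ k → ω i = ω' i) : Z.ζ0 j Y ω = Z.ζ0 j Y ω' :=
  h.zeta0_twoScale j Y ω ω' (hω j hjk.le) (hω (j + 1) hjk)

variable {F N} in
omit [NeZero N] in
/-- The two-scale law holds at the unit residual `ζ0 := 1`, `quad := 0` (range witness, as 12b's `localLaws_one`). [cite: Balaban1988Convergent, (2.21) p.258 (bookkeeping)] -/
theorem TkResidualW.localLaws₂_one {V : Type} (K : ℕ) : (⟨fun _ _ _ => 1, fun _ _ _ => 0⟩ : TkResidualW F N V K).LocalLaws₂ :=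
  (TkResidualW.localLaws_one (F := F) (N := N) (V := V) K).localLaws₂

omit [NeZero N] in
/-- The two-scale law holds for K0b's `ZtOfRecordQ q`, ANY `q` (its `ζ0` is the uniform constant). [cite: Balaban1988Convergent, (3.16)–(3.20) pp.268–269 (bookkeeping)] -/
theorem ztLocalLaws₂_ZtOfRecordQ (K : ℕ) (q : ℕ → Set (Site (F.P K) 0) → Tk.MultiCfg (F.P K) (SU N) (FluctV N) → ℝ) :
    (ZtOfRecordQ F N K q).LocalLaws₂ :=
  (ztLocalLaws_ZtOfRecordQ F N K q).localLaws₂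

omit [NeZero N] in
/-- The two-scale law holds for K0b's residual of record `ZtOfRecord`. [cite: Balaban1988Convergent, (3.16)–(3.20) pp.268–269 (bookkeeping)] -/
theorem ztLocalLaws₂_ZtOfRecord (K : ℕ) : (ZtOfRecord F N K).LocalLaws₂ :=
  (ztLocalLaws_ZtOfRecord F N K).localLaws₂

/-! ## §2  The θ-level named predicates a re-pinned proviso row would display, and their derivation from the rows of record -/

/-- **THE TWO-SCALE LOCALITY ROW AT STAGE 12, NAMED**: every `θ.Zt K` obeys the two-scale law (the print-faithful text for the row `ztLocal` of `Provisos₁₂` ∕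
`Provisos₁₃`; weaker than it). [cite: Balaban1988Convergent, (3.2)–(3.3) p.265, p.267] -/
def Stage12Params.ZtLocalLaws₂ (θ : Stage12Params F N) : Prop :=
  ∀ K, (θ.Zt K).LocalLaws₂

/-- **THE TWO-SCALE LOCALITY ROW AT THE HISTORY-INDEXED RESIDUAL, NAMED**: every `θ.Zh p n Ω Λ` obeys the two-scale law (the print-faithful text for the row
`zhLocal` of `Stage13HParams.Provisos₁₃CoPH` ∕ `Provisos₁₃SepCoPH` — cure text (b′) of FLAG №1 N11; weaker than the row of record). [cite: Balaban1988Convergent, (3.2)–(3.3) p.265, p.267, (3.16)–(3.20) pp.268–269] -/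
def Stage13HParams.ZhLocalLaws₂ (θ : Stage13HParams F N) : Prop :=
  ∀ (p : B12.RunParams) (n : ℕ) (Ω Λ : ℕ → Set (Site (F.P p.K) 0)), (θ.Zh p n Ω Λ).LocalLaws₂

variable {F N}

/-- The row of record `ztLocal` of `Provisos₁₂` gives the two-scale row. [cite: Balaban1988Convergent, (3.2)–(3.3) p.265 (bookkeeping)] -/
theorem Stage12Params.Provisos₁₂.ztLocalLaws₂ {θ : Stage12Params F N} (h : θ.Provisos₁₂ F N) : θ.ZtLocalLaws₂ F N :=
  fun K => (h.ztLocal K).localLaws₂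

/-- K0b's residuals of record give the two-scale row (hypothesis-free at `HasResidualsOfRecord`). [cite: Balaban1988Convergent, (3.16)–(3.20) pp.268–269 (bookkeeping)] -/
theorem Stage12Params.HasResidualsOfRecord.ztLocalLaws₂ {θ : Stage12Params F N} (h : θ.HasResidualsOfRecord F N) : θ.ZtLocalLaws₂ F N :=
  fun K => (h.ztLocal K).localLaws₂

/-- The row of record `ztLocal` of `Provisos₁₃` gives the two-scale row. [cite: Balaban1988Convergent, (3.2)–(3.3) p.265 (bookkeeping)] -/
theorem Stage13Params.Provisos₁₃.ztLocalLaws₂ {θ : Stage13Params F N} (h : θ.Provisos₁₃ F N) : θ.toStage12Params.ZtLocalLaws₂ F N :=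
  fun K => (h.ztLocal K).localLaws₂

/-- The core proviso row `zhLocal` of `Provisos₁₃CoPH` gives the two-scale row. [cite: Balaban1988Convergent, (3.2)–(3.3) p.265, (3.16)–(3.20) pp.268–269 (bookkeeping)] -/
theorem Stage13HParams.Provisos₁₃CoPH.zhLocalLaws₂ {θ : Stage13HParams F N} (h : θ.Provisos₁₃CoPH F N) : θ.ZhLocalLaws₂ F N :=
  fun p n Ω Λ => (h.zhLocal p n Ω Λ).localLaws₂

/-- K1⁹'s proviso row `zhLocal` of `Provisos₁₃SepCoPH` gives the two-scale row. [cite: Balaban1988Convergent, (3.2)–(3.3) p.265, (3.16)–(3.20) pp.268–269 (bookkeeping)] -/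
theorem Stage13HParams.Provisos₁₃SepCoPH.zhLocalLaws₂ {θ : Stage13HParams F N} (h : θ.Provisos₁₃SepCoPH F N) : θ.ZhLocalLaws₂ F N :=
  fun p n Ω Λ => (h.zhLocal p n Ω Λ).localLaws₂

/-- The two-scale law of the history's residual `θ.zhAt p s` FROM the two-scale row of every `θ.Zh p n Ω Λ` (as `zhAt_localLaws`). [cite: Balaban1988Convergent, (3.2)–(3.3) p.265 (bookkeeping)] -/
theorem Stage13HParams.zhAt_localLaws₂ {θ : Stage13HParams F N} (hZ : θ.ZhLocalLaws₂ F N) (p : B12.RunParams) {n : ℕ}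
    (s : SeqOfRecord F θ.ν θ.τ9.M (gOfRecord₁₃ F N θ.toStage13Params p) p.K n) : (θ.zhAt p s).LocalLaws₂ :=
  hZ p n s.Ω s.Λ

/-! ## §3 (v1.1, T0′ of the R2b cure — plan g91 word 2026-08-29T04:07Z)  The INTRODUCTION FUNNEL -/

omit [NeZero N] in
/-- **THE INTRODUCTION FUNNEL**: a residual whose `ζ0 j Y` reads scale `j` ONLY (the explicit one-scale statement) obeys the row of record `LocalLaws`.  Its proof (v1.2) is
arity-robust: it elaborates under the one-scale row of record and, unchanged, after the R2b cure (the row's field weakened IN PLACE to the two-scale type,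
`Node00/Record12.lean`) — ONE lemma absorbs the arity change for every introduction site that goes through it (`…N11HistoryPinnedResidualDefs`,
`…N11NoExpansionZetaSpecAtCoP`, K0a's `localLaws_ZrOfRecord₁₃`, 12a's `ztLocalLaws_ZtOfRecordQ`).  Companion of the ELIMINATION funnel `LocalLaws.localLaws₂`.
[cite: Balaban1988Convergent, (3.2)–(3.3) p.265, p.267 (bookkeeping)] -/
theorem TkResidualW.LocalLaws.of_oneScale {V : Type} {K : ℕ} {Z : TkResidualW F N V K}
    (h : ∀ (j : ℕ) (Y : Set (Site (F.P K) 0)) (ω ω' : Tk.MultiCfg (F.P K) (SU N) V), ω j = ω' j → Z.ζ0 j Y ω = Z.ζ0 j Y ω') : Z.LocalLaws := by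
  -- v1.2 (W2, dag-n11-d g32): ARITY-ROBUST under both rows (after `intro` of the five shared binders the goal is `E` today and `A → E` after T1′; `tauto` closes both).
  constructor
  intro j Y ω ω' hj
  have e := h j Y ω ω' hj
  tauto

omit [NeZero N] in
/-- A one-scale residual obeys the two-scale law (through the two funnels). [cite: Balaban1988Convergent, (3.2)–(3.3) p.265, p.267 (bookkeeping)] -/
theorem TkResidualW.LocalLaws₂.of_oneScale {V : Type} {K : ℕ} {Z : TkResidualW F N V K}
    (h : ∀ (j : ℕ) (Y : Set (Site (F.P K) 0)) (ω ω' : Tk.MultiCfg (F.P K) (SU N) V), ω j = ω' j → Z.ζ0 j Y ω = Z.ζ0 j Y ω') : Z.LocalLaws₂ :=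
  (TkResidualW.LocalLaws.of_oneScale h).localLaws₂

end Literature.MathematicalPhysics.QuantumFieldTheory.Balaban1983to89.Node00

end
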